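import Summits.BirchSwinnertonDyer.BirchSwinnertonDyer.Theorems.SmallImageMuTransferMuTransferX9TameClassLevel
import Summits.BirchSwinnertonDyer.BirchSwinnertonDyer.Theorems.SmallImageMuTransferMuTransferX9KolyvaginValueDivision
import Summits.BirchSwinnertonDyer.BirchSwinnertonDyer.Theorems.SmallImageMuTransferMuTransferX9StepsTwoFourTransportDistinguished
import HarnessLib

/-!
# K6 crux `MuTransferX9` (stmt-BirchSwinnertonDyer-19276), skeleton v6d stub `stub_stepsTwoFourOdd`,
# input «G3a», file 6: the VALUE INPUT — the genuine tame cocycle at level `L = p^{n+1}` with its norm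
# relation in OPERATOR form `ψ'(g) = (φ̃ − 1)((φ̃ − 1)(φ(g)))`, `φ̃ = (1+S)^{pⁿu}` THE ACTION OF EVERY
# LOCAL FROBENIUS AT `q` on `𝒯_L`, so that the division step is k6-g3's
# `neg_castLE_eq_shiftEnd_pow_aeval_castLE` verbatim

Cell `bsd-smallim`, seat `bsd-smallim-koly` (gen 9).  THEOREMS ONLY (no definition, no named fact, no
`sorry`).  HONEST FRAMING: helper toward the open stub `stub_stepsTwoFourOdd` of the crux `MuTransferX9`
(skeleton v6d `100eb8c6a7ccf73b`); closes nothing.  Consumers: the discharge of the assembler's bundled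
hypothesis `hKoly` (HOME/lurb/STEPS24-hKoly.lean.txt) through x10's
`KolyvaginTwist.exists_kolyvaginCocycle_value` (p469014: inputs `y'`, `hyI'`, `ψ'`, `hnorm`, `hψJ` — all
produced here — and output the key relation `(res r)·a' − a' = −ψ'(res r)`), followed by k6-g3's
division `neg_castLE_eq_shiftEnd_pow_aeval_castLE` (whose `hrel` is the key relation once `ψ'(res r)` is
written `(φ̃ − 1)(S^{pⁿ}·V(S)·φ(res r))` with `φ̃ = 𝒯_L(res r)` — the clauses `hact`/`hψ` below).

* `apply_absGaloisRestrict_eq_of_isArithFrobAt` — `κ(res r) = κ(Fr)` for every local Frobenius `r` at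
  `q ∤ p` and every global arithmetic Frobenius `Fr` at a prime over `q` (`κ` is abelian and kills the
  inertia at `q`; x9 `exists_forall_isAbsArithFrob_mul_inv_conj_mem_map_absInertia`).
* `aeval_one_sub_X_sq_apply`, `castLE_unipotentPow_sub_one_sq_apply_eq_zero` — `P̄((1+S)^a)` for
  `P̄ = (1 − X)²` is `(φ̃ − 1)²`, and `(φ̃ − 1)² x ≡ 0 (mod T^J)` for `φ̃ = (1+S)^{pⁿu}`, `J ≤ 2pⁿ`
  (k6-g3 `exists_poly_unipotentPow_sub_one_eq`: `φ̃ − 1 = S^{pⁿ}·V(S)`).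
* **`exists_tameCocycle_valueInput`** — for `IsEulerSystemClass W p κ γ I s`: a finite `S₀` such that
  for `q ∉ S₀`, `𝔓 ∣ q`, an `E`-split arithmetic Frobenius `Fr` at `𝔓` of depth `n`: `(p) ∉ q`, `E[p]`
  unramified at `q`, `p ∣ ℓ − 1`, and `∃ u y'`, `p ∤ u`, (act) every local Frobenius `r` of `ℚ_q` acts on
  `𝒯_{p^{n+1}}` by `(1+S)^{pⁿu}`, (I1) `y'` integral, and for every cocycle `φ` of
  `(I.redTower s)_{p^{n+1}}` a cocycle `ψ'` with `ψ'(g) = (φ̃−1)((φ̃−1)(φ g))`, `cor_N [y'] = [ψ']`, and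
  `ψ'(g) mod T^J = 0` for all `J ≤ 2pⁿ` — p469014's `(y', hyI', ψ', hnorm, hψJ)` and its `hpq hunr hdvd`.

References: K. Kato, Astérisque 295 (2004) (8.1.3), (13.1.1), Ex. 13.3 [Kato2004Asterisque]; K. Rubin,
*Euler Systems* (2000) §4.4 [Rubin2000]; L. Washington, *Introduction to Cyclotomic Fields* §13.1–13.2,
Prop. 13.2 [Washington1997]; HOME/koly/MU-TRANSFER-PROOF.md (F5), §3 (3.1).
-/

-- the summit and its single problem are both named `BirchSwinnertonDyer` (registry layout D-0017)
set_option linter.dupNamespace false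
set_option autoImplicit false

noncomputable section

open CategoryTheory Function Finset Polynomial
open scoped NumberField Pointwise ContRepresentation
open Field IsDedekindDomain
open Literature.NumberTheory.GaloisRepresentations
open Literature.NumberTheory.GaloisRepresentations.IsNonarchimedeanLocalField
open Literature.NumberTheory.EllipticCurves
open Literature.NumberTheory.EllipticCurves.ZpExtension
open Literature.NumberTheory.EllipticCurves.Kato2004
open Literature.NumberTheory.EllipticCurves.Kato2004.EulerSystemValues
open Rat.HeightOneSpectrum
open Summit.BirchSwinnertonDyer.Rank1Residual.GaloisImage

namespace Summit.BirchSwinnertonDyer.BirchSwinnertonDyer.Rank1Residual.TameClass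

/-! ## §1 `κ(res r) = κ(Fr)`: a `ℤ_p`-extension sees all Frobenii at `q ∤ p` alike -/

section Kappa

variable {p : ℕ} [Fact p.Prime] (κ : ZpExtension ℚ p)

/-- **`κ(res r) = κ(Fr)`** for a local arithmetic Frobenius `r` of `ℚ_q` and a global arithmetic
Frobenius `Fr` at any prime `𝔓 ∣ q`, `q ∤ p`: `res r = j · (t·Fr·t⁻¹)` with `j ∈ I_{𝔓₀}`
(x9 `exists_forall_isAbsArithFrob_mul_inv_conj_mem_map_absInertia`), `κ` kills `I_{𝔓₀}` (`q ∤ p`,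
`ZpExtension.inertia_le_kerSubgroup_holds`) and `κ` has abelian values. [cite: Washington1997, Prop. 13.2] -/
theorem apply_absGaloisRestrict_eq_of_isArithFrobAt {q : HeightOneSpectrum (𝓞 ℚ)}
    (hqp : (p : 𝓞 ℚ) ∉ q.asIdeal) {𝔓 : Ideal (absIntegers (𝓞 ℚ) ℚ)} (h𝔓 : 𝔓 ∈ q.primesAbove)
    {Fr : absoluteGaloisGroup ℚ} (hFr : IsArithFrobAt (𝓞 ℚ) Fr 𝔓)
    {r : absoluteGaloisGroup (q.adicCompletion ℚ)} (hr : IsAbsArithFrob r) :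
    κ (absGaloisRestrict ℚ (q.adicCompletion ℚ) r) = κ Fr := by
  classical
  obtain ⟨t, -, ht⟩ :=
    StepsTwoFourTransport.exists_forall_isAbsArithFrob_mul_inv_conj_mem_map_absInertia h𝔓 hFr
  have hjI : absGaloisRestrict ℚ (q.adicCompletion ℚ) r * (t * Fr * t⁻¹)⁻¹ ∈
      (adicCompletionPrime ℚ q).inertia (absoluteGaloisGroup ℚ) := by
    rw [inertia_adicCompletionPrime_eq_map_absInertia]
    exact ht r hr
  have hκj : κ (absGaloisRestrict ℚ (q.adicCompletion ℚ) r * (t * Fr * t⁻¹)⁻¹) = 1 :=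
    ZpExtension.mem_kerSubgroup.1
      (ZpExtension.inertia_le_kerSubgroup_holds ℚ p κ hqp (adicCompletionPrime_mem_primesAbove ℚ q) hjI)
  have h : κ (absGaloisRestrict ℚ (q.adicCompletion ℚ) r) =
      κ (absGaloisRestrict ℚ (q.adicCompletion ℚ) r * (t * Fr * t⁻¹)⁻¹) * κ (t * Fr * t⁻¹) := by
    rw [← map_mul, inv_mul_cancel_right]
  rw [h, hκj, one_mul, map_mul, map_mul, map_inv, mul_right_comm, mul_inv_cancel, one_mul]

end Kappa

/-! ## §2 The operator `P̄((1+S)^a) = ((1+S)^a − 1)²` for `P̄ = (1 − X)²` -/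

section Operator

variable {p : ℕ} [Fact p.Prime] {M : Type} [AddCommGroup M]

omit [Fact p.Prime] in
/-- `aeval T ((1 − X)²) x = (T − 1)((T − 1) x)`. [cite: Washington1997, §13.1–§13.2] -/
theorem aeval_one_sub_X_sq_apply {J : ℕ} (T : Module.End ℤ (Fin J → M)) (x : Fin J → M) :
    aeval T ((1 - X) ^ 2 : ℤ[X]) x = (T - 1) ((T - 1) x) := by
  rw [map_pow, map_sub, map_one, aeval_X, ← neg_sub, neg_sq, sq, Module.End.mul_apply]

/-- **`((1+S)^{pⁿu} − 1)² x ≡ 0 (mod T^J)` for `J ≤ 2pⁿ`**: `(1+S)^{pⁿu} − 1 = S^{pⁿ}·V(S)`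
(k6-g3 `exists_poly_unipotentPow_sub_one_eq`, koly (F5)), and polynomials in `S` commute.
[cite: Washington1997, §13.1–§13.2] -/
theorem castLE_unipotentPow_sub_one_sq_apply_eq_zero (hM : ∀ x : M, p • x = 0) {L J : ℕ} (n u : ℕ)
    (hJL : J ≤ L) (hJ2 : J ≤ 2 * p ^ n) (x : Fin L → M) (i : Fin J) :
    (unipotentPow M L (p ^ n * u) - 1) ((unipotentPow M L (p ^ n * u) - 1) x) (Fin.castLE hJL i) = 0 := by
  obtain ⟨V, -, hV⟩ := KolyvaginTwist.exists_poly_unipotentPow_sub_one_eq (M := M) hM (J := L) n u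
  have hcomm : aeval (shiftEnd M L) V * shiftEnd M L ^ (p ^ n) =
      shiftEnd M L ^ (p ^ n) * aeval (shiftEnd M L) V :=
    ((LocalSplitPrime.commute_aeval_self (shiftEnd M L) V).pow_left (p ^ n)).eq.symm
  have h2 : (unipotentPow M L (p ^ n * u) - 1) * (unipotentPow M L (p ^ n * u) - 1) =
      shiftEnd M L ^ (2 * p ^ n) * (aeval (shiftEnd M L) V * aeval (shiftEnd M L) V) := by
    rw [hV, mul_assoc, ← mul_assoc (aeval _ V), hcomm, mul_assoc, ← mul_assoc, ← pow_add, ← two_mul]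
  rw [← Module.End.mul_apply, h2, Module.End.mul_apply, shiftEnd_pow_apply,
    dif_pos (show ((Fin.castLE hJL i : Fin L) : ℕ) < 2 * p ^ n from lt_of_lt_of_le i.2 hJ2)]

end Operator

/-! ## §3 The value input at an `E`-split Frobenius -/

section ValueInput

variable (W : WeierstrassCurve ℚ) [W.IsElliptic] [W.IsGloballyMinimal] (p : ℕ) [Fact p.Prime]
  [ContinuousSMul ℤ_[p] (W.tateModule p)]
  [Module.Free ℤ_[p] (W.tateModule p)] [Module.Finite ℤ_[p] (W.tateModule p)]
  (κ : ZpExtension ℚ p) (γ : absoluteGaloisGroup ℚ) (I : IwasawaH1Data W p κ γ)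

/-- **The VALUE INPUT of the Kolyvagin cocycle (G3a, operator form at the local Frobenius).**  For a
genuine Λ-adic Euler-system class `s` there is a finite `S₀` such that for every `q ∉ S₀` (prime `ℓ`),
`𝔓 ∣ q`, `E`-split arithmetic Frobenius `Fr` at `𝔓` of depth `n`: `q ∤ p`, `E[p]` is unramified at
`q`, `p ∣ ℓ − 1` (x10 p469014's `hpq`, `hunr`, `hdvd`), and there are `u` with `p ∤ u` and a cocycle `y'`
on `N = Gal(ℚ̄/ℚ(μ_ℓ))` in `𝒯_L`, `L = p^{n+1}`, such that: (act) EVERY local arithmetic Frobenius `r`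
of `ℚ_q` acts on `𝒯_L` by `φ̃ := (1+S)^{pⁿu}`; (I1) `y'` is integral (p469014's `hyI'`); and for every
cocycle `φ` of `𝐳̄₁ = (I.redTower s)_L` a cocycle `ψ'` with VALUES `ψ'(g) = (φ̃ − 1)((φ̃ − 1)(φ(g)))`,
the norm relation `cor_N [y'] = [ψ']` (p469014's `hnorm`) and `ψ'(g) mod T^J = 0` for all `J ≤ 2pⁿ`
(p469014's `hψJ`).  With p469014's key relation `(res r)·a' − a' = −ψ'(res r)` and (act), k6-g3's
`neg_castLE_eq_shiftEnd_pow_aeval_castLE` (`e := pⁿ`, `W := V` from `exists_poly_unipotentPow_sub_one_eq`,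
`t := φ(res r)`) yields `−(a' mod T^J) = S^{pⁿ}·V(S)·(φ(res r) mod T^J)`.
[cite: Kato2004Asterisque, (8.1.3), §13.1 (13.1.1) and Ex. 13.3] [cite: Rubin2000, Lemma 4.4.2]
[cite: Washington1997, §13.1–§13.2 and Prop. 13.2] -/
theorem exists_tameCocycle_valueInput {s : I.H} (hES : IsEulerSystemClass W p κ γ I s) :
    ∃ S₀ : Set (HeightOneSpectrum (𝓞 ℚ)), S₀.Finite ∧
      ∀ (q : HeightOneSpectrum (𝓞 ℚ)), q ∉ S₀ →
      ∀ {𝔓 : Ideal (absIntegers (𝓞 ℚ) ℚ)}, 𝔓 ∈ q.primesAbove →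
      ∀ {Fr : absoluteGaloisGroup ℚ}, IsArithFrobAt (𝓞 ℚ) Fr 𝔓 →
        WeierstrassCurve.galoisRepTorsion W p Fr = 1 →
      ∀ {n : ℕ}, Fr ∈ κ.layerSubgroup n → Fr ∉ κ.layerSubgroup (n + 1) →
      ∀ [NeZero ((primesEquiv q : Nat.Primes) : ℕ)]
        [Fintype (absoluteGaloisGroup ℚ ⧸ rootsOfUnityFixer ℚ ((primesEquiv q : Nat.Primes) : ℕ))],
      (p : 𝓞 ℚ) ∉ q.asIdeal ∧ GaloisRep.IsUnramifiedAt q (W.torsionGaloisModule (p : ℤ)) ∧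
      p ∣ ((primesEquiv q : Nat.Primes) : ℕ) - 1 ∧
      ∃ (u : ℕ) (y' : contOneCocycles (subgroupRep (κ.twistModP (W.torsionGaloisModule (p : ℤ))
            IwasawaH1Data.torsion_nsmul_eq_zero (p ^ (n + 1))).toTopRep
            (rootsOfUnityFixer ℚ ((primesEquiv q : Nat.Primes) : ℕ)))),
        ¬ p ∣ u ∧
        -- (act) every local Frobenius at `q` acts on `𝒯_{p^{n+1}}` by `(1+S)^{pⁿu}`
        (∀ r : absoluteGaloisGroup (q.adicCompletion ℚ), IsAbsArithFrob r →
          ∀ x : Fin (p ^ (n + 1)) → WeierstrassCurve.geomTorsion W (p : ℤ),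
            κ.twistModP (W.torsionGaloisModule (p : ℤ)) IwasawaH1Data.torsion_nsmul_eq_zero (p ^ (n + 1))
              (absGaloisRestrict ℚ (q.adicCompletion ℚ) r) x =
            unipotentPow (WeierstrassCurve.geomTorsion W (p : ℤ)) (p ^ (n + 1)) (p ^ n * u) x) ∧
        -- (I1) integrality of `y'`
        (∀ w : HeightOneSpectrum (𝓞 ℚ), (p : 𝓞 ℚ) ∉ w.asIdeal → ∀ 𝔓' ∈ w.primesAbove,
          resLe (κ.twistModP (W.torsionGaloisModule (p : ℤ)) IwasawaH1Data.torsion_nsmul_eq_zero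
              (p ^ (n + 1))).toTopRep
            (inf_le_left : rootsOfUnityFixer ℚ ((primesEquiv q : Nat.Primes) : ℕ) ⊓
              𝔓'.inertia (absoluteGaloisGroup ℚ) ≤ _) 1 (oneCocycleClass _ y') = 0) ∧
        -- the norm relation in operator form, with `hψJ`
        ∀ φ : contOneCocycles (κ.twistModP (W.torsionGaloisModule (p : ℤ))
            IwasawaH1Data.torsion_nsmul_eq_zero (p ^ (n + 1))).toTopRep,
          oneCocycleClass _ φ = (I.redTower s : ∀ J : ℕ, galoisCohomology (κ.twistModP
            (W.torsionGaloisModule (p : ℤ)) IwasawaH1Data.torsion_nsmul_eq_zero J) 1) (p ^ (n + 1)) →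
          ∃ ψ' : contOneCocycles (κ.twistModP (W.torsionGaloisModule (p : ℤ))
              IwasawaH1Data.torsion_nsmul_eq_zero (p ^ (n + 1))).toTopRep,
            (∀ g, ψ'.1 g =
              (unipotentPow (WeierstrassCurve.geomTorsion W (p : ℤ)) (p ^ (n + 1)) (p ^ n * u) - 1)
                ((unipotentPow (WeierstrassCurve.geomTorsion W (p : ℤ)) (p ^ (n + 1)) (p ^ n * u) - 1)
                  (φ.1 g))) ∧
            cores (κ.twistModP (W.torsionGaloisModule (p : ℤ)) IwasawaH1Data.torsion_nsmul_eq_zero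
                (p ^ (n + 1))).toTopRep (rootsOfUnityFixer ℚ ((primesEquiv q : Nat.Primes) : ℕ))
              (isOpen_rootsOfUnityFixer ℚ _) (oneCocycleClass _ y') = oneCocycleClass _ ψ' ∧
            ∀ {J : ℕ} (hJL : J ≤ p ^ (n + 1)), J ≤ 2 * p ^ n →
              ∀ (g : absoluteGaloisGroup ℚ) (i : Fin J), ψ'.1 g (Fin.castLE hJL i) = 0 := by
  classical
  obtain ⟨S₀, hS₀, hmain⟩ := exists_tameClass_of_isEulerSystemClass W p κ γ I hES
  obtain ⟨S₁, hS₁, hsub, hgood⟩ :=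
    TorsionUnramified.exists_finite_superset_isUnramifiedAt_torsionGaloisModule W (K := ℚ)
      (p := p) (Fact.out : p.Prime).ne_zero hS₀
  refine ⟨S₁, hS₁, ?_⟩
  intro q hq1 𝔓 h𝔓 Fr hFr hsplit n hFrn hFrn' _ _
  have hq0 : q ∉ S₀ := fun h ↦ hq1 (hsub h)
  obtain ⟨hqp, hqgood, hunr⟩ := hgood q hq1
  have hne : ((primesEquiv q : Nat.Primes) : ℕ) ≠ p := primesEquiv_ne_of_natCast_not_mem hqp
  have hFr' : IsArithFrobAtPlace ℚ q Fr := ⟨𝔓, h𝔓, hFr⟩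
  -- `p ∣ ℓ - 1`
  have hdvd : p ∣ ((primesEquiv q : Nat.Primes) : ℕ) - 1 := by
    have h1 : (((primesEquiv q : Nat.Primes) : ℕ) : ZMod p) = 1 :=
      EulerFactorModP.primesEquiv_eq_one_of_galoisRepTorsion_eq_one W p hne h𝔓 hFr hsplit
    have hle : 1 ≤ ((primesEquiv q : Nat.Primes) : ℕ) := (primesEquiv q).2.one_lt.le
    rw [← Nat.cast_one, ZMod.natCast_eq_natCast_iff] at h1
    exact (Nat.modEq_iff_dvd' hle).mp h1.symm
  -- the Euler factor and the exponent
  have hPz : ((1 - X) ^ 2 : ℤ[X]).map (Int.castRingHom (ZMod p)) =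
      (rubinEulerFactor (tateRep W p).toRepresentation (cyclotomicCharacterToUnits ℚ p ℤ_[p]) Fr).map
        (PadicInt.toZMod (p := p)) :=
    (EulerFactorModP.map_toZMod_rubinEulerFactor_eq_of_galoisRepTorsion_eq_one W p hne hqgood hFr'
      hsplit).symm
  obtain ⟨u, hu, ha⟩ := LocalSplitPrime.twistExponent_eq_prime_pow_mul_of_depth κ (J := n + 1) le_rfl
    hFrn hFrn'
  have ha' : ((p ^ n * u : ℕ) : ZMod (p ^ (n + 1))) = κ.layerIndex (n + 1) Fr := by
    rw [← ha]
    exact κ.natCast_twistExponent (n + 1) (n + 1) le_rfl Fr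
  obtain ⟨y, hyint, hynorm⟩ := hmain q hq0 (n + 1) Fr hFr' ((1 - X) ^ 2) hPz (p ^ n * u) ha'
    (isOpen_rootsOfUnityFixer ℚ _)
  obtain ⟨y', rfl⟩ := oneCocycleClass_surjective _ y
  refine ⟨hqp, hunr, hdvd, u, y', hu, fun r hr x ↦ ?_, fun w hw 𝔓' h𝔓' ↦ ?_, fun φ hφ ↦ ?_⟩
  · -- (act): `ρ̄(res r) = 1` and `κ(res r) = κ(Fr)`
    have hρ1 : W.torsionGaloisModule (p : ℤ) (absGaloisRestrict ℚ (q.adicCompletion ℚ) r) = 1 :=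
      (StepsTwoFourTransport.isSplit_and_depth_absGaloisRestrict_of_isArithFrobAt_rat W p κ hunr
        hqp h𝔓 hFr hsplit hFrn hFrn' hr).1
    have hexp : ((κ.twistExponent (p ^ (n + 1)) (absGaloisRestrict ℚ (q.adicCompletion ℚ) r) : ℕ) :
        ZMod (p ^ (n + 1))) = ((p ^ n * u : ℕ) : ZMod (p ^ (n + 1))) := by
      rw [κ.natCast_twistExponent (n + 1) (p ^ (n + 1))
        (Nat.lt_pow_self (Fact.out : p.Prime).one_lt).le, ha']
      unfold ZpExtension.layerIndex
      rw [apply_absGaloisRestrict_eq_of_isArithFrobAt κ hqp h𝔓 hFr hr]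
    rw [twistModP_apply, unipotentPow_eq_of_natCast_eq (n := n + 1) IwasawaH1Data.torsion_nsmul_eq_zero hexp]
    congr 1
    funext i
    rw [hρ1]
    rfl
  · exact (mem_integralH1_iff _ p _ _).1 hyint w (primesEquiv_ne_of_natCast_not_mem hw) 𝔓' h𝔓'
  · obtain ⟨ψ, hψ, hclass⟩ := hynorm φ hφ
    refine ⟨ψ, fun g ↦ ?_, hclass, fun hJL hJ2 g i ↦ ?_⟩
    · rw [hψ g, aeval_one_sub_X_sq_apply]
    · rw [hψ g, aeval_one_sub_X_sq_apply]
      exact castLE_unipotentPow_sub_one_sq_apply_eq_zero IwasawaH1Data.torsion_nsmul_eq_zero n u hJL hJ2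
        (φ.1 g) i

end ValueInput

end Summit.BirchSwinnertonDyer.BirchSwinnertonDyer.Rank1Residual.TameClass

end
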